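import Mathlib

/-!
# The clean-zone chain (stub `stub_chain`)

The stub `stub_chain` of the crux `MobiusLadder.QuadraticDigitPhases`
(stmt-QuantumAdvantage-1391), line `Sketch`, with its lemmas.  Mathlib only.

`C` is the (upper part of the) coefficient matrix of a quadratic form in the binary digits
`x_0, …, x_{n-1}`: `C a j ≠ 0` with `a < j` means digit `a` is read at the later position `j`.
The cut matrix at `c` keeps the entries `(i, j)` with `i < c ≤ j`; all cut ranks are assumed `< R₀`.
Given a source `a` read at `j > a + ℓ R₀`, we find a source `a' ∈ [a, a + ℓ R₀)` whose last reading
`j' ≥ j` dominates the last readings of every source in the window `(a', a' + ℓ)`.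

Proof: follow the chain `a = a_0, a_1, …` where `a_{i+1} ∈ (a_i, a_i + ℓ)` is a source read beyond
the last reading of `a_i`; the last readings strictly increase, so the rows `a_0, …, a_t` and their
last readings form a triangular pattern with nonzero diagonal inside the cut matrix at `a_t + 1`,
forcing `t + 1 ≤ rank < R₀`.  Hence the chain stops after fewer than `R₀` steps, inside
`[a, a + ℓ R₀)`, and its last element is the required `a'`.
-/

set_option linter.dupNamespace false -- D-0017: single-problem summit ⇒ `QuantumAdvantage.QuantumAdvantage` by design

namespace Summit.QuantumAdvantage.QuantumAdvantage.Theorems.MobiusLadderQuadraticDigitPhasesStubChain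

/-- A triangular pattern with nonzero diagonal bounds the rank from below: if the entries
`M (f i) (g i)` are nonzero and `M (f i') (g i) = 0` for `i < i'`, then `r ≤ rank M`. -/
theorem le_rank_of_triangular {K m₁ m₂ : Type*} [Field K] [Fintype m₂] {r : ℕ} (M : Matrix m₁ m₂ K)
    (f : Fin r → m₁) (g : Fin r → m₂) (hdiag : ∀ i, M (f i) (g i) ≠ 0)
    (htri : ∀ i i', i < i' → M (f i') (g i) = 0) : r ≤ M.rank := by
  classical
  have hS : (M.submatrix f g).BlockTriangular id := fun i' i h => htri i i' h
  have hdet : (M.submatrix f g).det ≠ 0 := by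
    rw [Matrix.det_of_upperTriangular hS]
    exact Finset.prod_ne_zero_iff.mpr fun i _ => hdiag i
  have hunit : IsUnit (M.submatrix f g) :=
    (Matrix.isUnit_iff_isUnit_det _).mpr (isUnit_iff_ne_zero.mpr hdet)
  calc r = Fintype.card (Fin r) := (Fintype.card_fin r).symm
    _ = (M.submatrix f g).rank := (Matrix.rank_of_isUnit _ hunit).symm
    _ ≤ M.rank := Matrix.rank_submatrix_le M f g

/-- A source with a reading has a last reading. -/
theorem exists_last_reading {n : ℕ} {C : Fin n → Fin n → ZMod 2} {b k : Fin n} (h : C b k ≠ 0) :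
    ∃ k', C b k' ≠ 0 ∧ ∀ k, C b k ≠ 0 → k ≤ k' := by
  obtain ⟨k', hk', hmax⟩ :=
    (Finset.univ.filter fun k : Fin n => C b k ≠ 0).exists_max_image (fun k => k) ⟨k, by simpa using h⟩
  exact ⟨k', by simpa using hk', fun k hk => hmax k (by simpa using hk)⟩

/-- The chain induction.  A chain of `t + 1` sources `f i` (current one `f 0`, all `≤ f 0`) with last
readings `g i`, strictly decreasing in `i` and all `≥ j`, with `f 0 ≤ a + t (ℓ - 1)` and
`t + d = R₀`, leads to the required clean source; by induction on `d`, the case `d = 0` being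
excluded by the rank bound at the cut `f 0 + 1`. -/
theorem chain_induction {n R₀ ℓ : ℕ} (C : Fin n → Fin n → ZMod 2) (hℓ : 0 < ℓ)
    (hrank : ∀ c : ℕ,
      (Matrix.of fun (i j : Fin n) => if (i : ℕ) < c ∧ c ≤ (j : ℕ) then C i j else 0).rank < R₀)
    (a j : Fin n) (hj : (a : ℕ) + ℓ * R₀ < j) :
    ∀ d t : ℕ, t + d = R₀ → ∀ f g : Fin (t + 1) → Fin n,
      (a : ℕ) ≤ f 0 → (f 0 : ℕ) + t ≤ a + t * ℓ → (∀ i, f i ≤ f 0) → (∀ i, C (f i) (g i) ≠ 0) →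
      (∀ i k, g i < k → C (f i) k = 0) → (∀ i i', i < i' → g i' < g i) → (∀ i, g i ≤ g 0) →
      (∀ i, j ≤ g i) →
      ∃ a' j' : Fin n, (a : ℕ) ≤ a' ∧ (a' : ℕ) < a + ℓ * R₀ ∧ (j : ℕ) ≤ j' ∧ (a' : ℕ) < j' ∧
        C a' j' ≠ 0 ∧ (∀ k : Fin n, (a' : ℕ) < k → C a' k ≠ 0 → (k : ℕ) ≤ j') ∧
        ∀ b k : Fin n, (a' : ℕ) < b → (b : ℕ) < a' + ℓ → (b : ℕ) < k → C b k ≠ 0 → (k : ℕ) ≤ j' := by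
  have hR : 0 < R₀ := lt_of_le_of_lt (Nat.zero_le _) (hrank 0)
  intro d
  induction d with
  | zero =>
    intro t ht f g ha hpos hrows hdiag hreach hanti hgmax hjg
    exfalso
    simp only [Nat.add_zero] at ht
    subst ht
    have hcomm : t * ℓ = ℓ * t := Nat.mul_comm t ℓ
    have hb : (f 0 : ℕ) < a + ℓ * t := by omega
    have hle : t + 1 ≤ (Matrix.of fun (i j : Fin n) =>
        if (i : ℕ) < (f 0 : ℕ) + 1 ∧ (f 0 : ℕ) + 1 ≤ (j : ℕ) then C i j else 0).rank := by
      refine le_rank_of_triangular _ f g (fun i => ?_) (fun i i' hii' => ?_)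
      · have h1 := hrows i
        have h2 := hjg i
        rw [Matrix.of_apply, if_pos ⟨by omega, by omega⟩]
        exact hdiag i
      · rw [Matrix.of_apply]
        simp [hreach i' (g i) (hanti i i' hii')]
    have := hle.trans_lt (hrank ((f 0 : ℕ) + 1))
    omega
  | succ d ih =>
    intro t ht f g ha hpos hrows hdiag hreach hanti hgmax hjg
    have h1 : t * ℓ + ℓ ≤ ℓ * R₀ := by
      have := Nat.mul_le_mul_right ℓ (show t + 1 ≤ R₀ by omega)
      rwa [Nat.succ_mul, Nat.mul_comm R₀] at this
    have hb : (f 0 : ℕ) < a + ℓ * R₀ := by omega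
    by_cases hex : ∃ b k : Fin n, f 0 < b ∧ (b : ℕ) < (f 0 : ℕ) + ℓ ∧ g 0 < k ∧ C b k ≠ 0
    · obtain ⟨b, k, hb1, hb2, hk, hCbk⟩ := hex
      obtain ⟨k', hk'C, hk'max⟩ := exists_last_reading hCbk
      have hkk' : g 0 < k' := lt_of_lt_of_le hk (hk'max k hCbk)
      have hsucc : (t + 1) * ℓ = t * ℓ + ℓ := Nat.succ_mul t ℓ
      refine ih (t + 1) (by omega) (Matrix.vecCons b f) (Matrix.vecCons k' g) ?_ ?_ ?_ ?_ ?_ ?_ ?_ ?_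
      · simp only [Matrix.cons_val_zero]
        exact ha.trans (Fin.le_def.1 hb1.le)
      · simp only [Matrix.cons_val_zero]
        omega
      · refine Fin.forall_fin_succ.2 ⟨le_rfl, fun i => ?_⟩
        simp only [Matrix.cons_val_succ, Matrix.cons_val_zero]
        exact (hrows i).trans hb1.le
      · refine Fin.forall_fin_succ.2 ⟨by simpa using hk'C, fun i => ?_⟩
        simpa using hdiag i
      · refine Fin.forall_fin_succ.2 ⟨fun k hk => ?_, fun i k hk => ?_⟩
        · simp only [Matrix.cons_val_zero] at hk ⊢
          by_contra hC
          exact absurd (hk'max k hC) (not_le.2 hk)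
        · simp only [Matrix.cons_val_succ] at hk ⊢
          exact hreach i k hk
      · intro i
        refine Fin.forall_fin_succ.2 ⟨fun h => absurd h (Fin.not_lt_zero i) , fun i' h => ?_⟩
        revert h
        refine Fin.cases (fun _ => ?_) (fun i h => ?_) i
        · simp only [Matrix.cons_val_succ, Matrix.cons_val_zero]
          exact lt_of_le_of_lt (hgmax i') hkk'
        · simp only [Matrix.cons_val_succ]
          exact hanti i i' (Fin.succ_lt_succ_iff.1 h)
      · refine Fin.forall_fin_succ.2 ⟨le_rfl, fun i => ?_⟩
        simp only [Matrix.cons_val_succ, Matrix.cons_val_zero]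
        exact ((hgmax i).trans hkk'.le)
      · refine Fin.forall_fin_succ.2 ⟨?_, fun i => ?_⟩
        · simp only [Matrix.cons_val_zero]
          exact (hjg 0).trans hkk'.le
        · simp only [Matrix.cons_val_succ]
          exact hjg i
    · push Not at hex
      have hj0 := hjg 0
      refine ⟨f 0, g 0, ha, hb, by omega, by omega, hdiag 0, fun k hk hC => ?_,
        fun b k hb1 hb2 _ hC => ?_⟩
      · by_contra h
        exact hC (hreach 0 k (by omega))
      · by_contra h
        exact hC (hex b k (by omega) hb2 (by omega))

/-- **Clean-zone chain.**  If all cut ranks of `C` are `< R₀` and the source `a` is read at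
`j > a + ℓ R₀`, then some source `a' ∈ [a, a + ℓ R₀)` has its last reading `j' ≥ j`, and every
source in the window `(a', a' + ℓ)` is read no later than `j'`. -/
theorem stub_chain :
    ∀ (n R₀ ℓ : ℕ) (C : Fin n → Fin n → ZMod 2), 0 < ℓ →
      (∀ c : ℕ, (Matrix.of fun (i j : Fin n) => if (i : ℕ) < c ∧ c ≤ (j : ℕ) then C i j else 0).rank < R₀) →
      ∀ a j : Fin n, C a j ≠ 0 → (a : ℕ) + ℓ * R₀ < j →
      ∃ a' j' : Fin n, (a : ℕ) ≤ a' ∧ (a' : ℕ) < a + ℓ * R₀ ∧ (j : ℕ) ≤ j' ∧ (a' : ℕ) < j' ∧ C a' j' ≠ 0 ∧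
        (∀ k : Fin n, (a' : ℕ) < k → C a' k ≠ 0 → (k : ℕ) ≤ j') ∧
        ∀ b k : Fin n, (a' : ℕ) < b → (b : ℕ) < a' + ℓ → (b : ℕ) < k → C b k ≠ 0 → (k : ℕ) ≤ j' := by
  intro n R₀ ℓ C hℓ hrank a j haj hj
  obtain ⟨k', hk'C, hk'max⟩ := exists_last_reading haj
  refine chain_induction C hℓ hrank a j hj R₀ 0 (by omega) (fun _ => a) (fun _ => k') le_rfl
    (by omega) (fun _ => le_rfl) (fun _ => hk'C) (fun _ k hk => ?_) (fun i i' h => ?_)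
    (fun _ => le_rfl) (fun _ => hk'max j haj)
  · by_contra hC
    exact absurd (hk'max k hC) (not_le.2 hk)
  · exact absurd (Fin.lt_def.1 h) (by omega)

end Summit.QuantumAdvantage.QuantumAdvantage.Theorems.MobiusLadderQuadraticDigitPhasesStubChain
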